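import Literature.MathematicalPhysics.QuantumFieldTheory.Balaban1983to89.Node00.BetaOfRecord
import Literature.MathematicalPhysics.QuantumFieldTheory.Balaban1983to89.Node00.RateRecord11
import Literature.MathematicalPhysics.QuantumFieldTheory.Balaban1983to89.Node00.Record13
import Literature.MathematicalPhysics.QuantumFieldTheory.Balaban1983to89.T4BetaReadOut
import Literature.MathematicalPhysics.QuantumFieldTheory.Balaban1983to89.B12Sec2to5

/-!
# NODE 00 ∕ W1 — NODE U3's OBJECTS KEYED TO THE LIMITING (1.21) KERNELS OF A TERM FAMILY:
# the history-dependent terms `E^{(k+1)}(g_0, …, g_k; ·)` of [I] (2.13) ∕ [II] (2.13)–(2.14) read, NOT as finite-volume functionals on a run's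
# torus, but through their `ℤ⁴`-KERNELS `Π_{k+1,μν}(g_0, …, g_k; z)` of [I] (1.20)–(1.21) after the limit «T^{(k+1)} ↗ Z^d» (the tree's TOTAL
# `Node00.polLimit`), on ONE background-free pair carrier indexed by `(k, μ, ν, z)` — so that the (1.22) read-out `β_{k+1} = Σ_z Π z_μ z_ν`
# of the β-layer of record (`Node00.betaMerged ∕ betaOfMerged`) is REPRESENTED on these objects by `rfl`-grade unfolding.

Seat `pub-ymgap-node00-def-W1` g28 (DEFINER; object W1 = [Balaban1988RG2Cluster] §2 (2.13)–(2.14): the older, history-dependent terms read on the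
new step's carriers; Literature side, hypothesis-schema style, D-0064 one file per source section).  This storey answers the bus input of seat
`dag-n27-w1` (2026-08-28, «(q1)»): «a U3 READING KEYED TO def-B's LIMITING (1.21) KERNEL — define `u3Objects` whose level functional STORES
`polLimit F (k+1) (ℰ k v ·) ρ bV μ ν z` at ℤ⁴-indexed scale-(k+1) carrier points of tree length `|z|₁`».

## The objects (parameters: a torus catalogue `F`, a remainder term family `ℰ : Node00.TermFamily1 F 𝔄` — [I] (2.13) p. 268 for a FREE
## coupling history `(g_0, …, g_k) : Fin (k+1) → ℝ` on the `K`-th torus —, the probe `ρ : V →L[ℝ] 𝔄` and basis `bV` of (1.20)'s Hessian)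

* §1 **`carriers`** — ONE `T4OutputRate.Carriers`: domains `Dom = ℕ × Fin 4 × Fin 4 × (Fin 4 → ℤ)`, the point `pt k μ ν z = (k, μ, ν, z)` having
  creation scale `k + 1` and tree length `|z|₁` (`B12Sec2to5.l1`; [I] (0.24)–(0.25) p. 257: the kernel entry at separation `z` is carried by
  localization domains containing `0` and `z`, of tree length `≥ |z|₁`); BOTH background types the ONE-POINT type `PUnit`, gauge `0`, identity
  transport — FAITHFUL to print: after (1.20)–(1.21) p. 264 the kernel `Π_{k+1,μν}(g; x − x′)` is the Hessian in the background field `B` AT `B = 0`,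
  a real number per `(μ, ν, x − x′)`; no background variable is left.  (The tree's `T4BetaReadOut.betaCarriers` is the same design one printed
  step SHALLOWER: it stores the numbers `β_{k+1}` of (1.22); this carrier stores the kernels of (1.21), which is what makes the read-out
  constant and the transport-covariance of the (1.22) recipe PROVABLE — seat n27-w1's `readBoundedOn_kernelSlice ∕ readCovariantOn_kernelSlice`,
  Summit side — instead of conventional.)  `histPrefix g k = (g_0, …, g_k)` cuts a coupling sequence to the history a level-`k` term reads.
* §2 **`kernelA F ℰ ρ bV g k`** `= polLimit F (k+1) (fun K => ℰ k (histPrefix g k) K) ρ bV : B12Beta.Kernel 4` — run A's limiting kernel of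
  level `k + 1` at the coupling sequence `g`; **`kernelB F ℰ ρ bV b g k = kernelA F ℰ ρ bV (prependCoupling b g) (k + 1)`** — run B's, one
  level up, with run B's UNPAIRED first coupling `b` prepended to the re-indexed sequence (`Node00.prependCoupling`, node U3's unprinted pairing
  `j ↦ j + 1` of [I] (0.24)–(0.25), the convention of `U3Tower₁₁.EB` and of `T4BetaReadOut.RepresentsB`); the level functionals
  **`EA F ℰ ρ bV : Functional carriers PUnit`**, `EA g _ (k, μ, ν, z) = kernelA g k μ ν z`, and **`EB F ℰ ρ bV b`** likewise.
  KEY FACES (★): `EA_extd` — along a box history `v : Fin (k+1) → ℝ` padded by `T4FlagMemory.extd`, `EA (extd v) _ (pt k μ ν z) =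
  polLimit F (k+1) (fun K => ℰ k v K) ρ bV μ ν z`; `EB_extd_tail` — `EB (w 0) (extd (Fin.tail w)) _ (pt k μ ν z) = polLimit F (k+2) (fun K =>
  ℰ (k+1) w K) ρ bV μ ν z`: VERBATIM the two «storage clauses» `hstore` of n27-w1's `representsA∕B_betaOfMerged_of_stores_polLimit`.
* §3 **`objects F ℰ ρ bV ℓ : Node00.U3Objects₁₁`** `= U3Objects₁₁.ofFixed carriers (EA …) (EB …) ℓ` for a K-uniform letter block
  `ℓ : U3Letters₁₁` (the fixed-carrier constructor of record, `Node00/RateRecord11`), with its `rfl` faces and `objects_populated`.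
* §4 **THE SLOT DICTIONARY** — what node U3's hypothesis shapes (`T4OutputRate`) and the read-out clauses (`T4BetaReadOut`) SAY at these
  objects, as `Iff`s or by construction: `decayBound_EA_iff` ((0.25)∕(1.18) decay ⟺ (5.10)-decay `B12Sec2to5.Decay510` of every stored kernel with
  the UNIFORM constant); `ne9_EA_iff` (NE9 ⟺ joint history-Lipschitz bounds on the kernels); `ne5_iff` (NE5 at first coupling `b` ⟺
  `|kernelA g k μ ν z − kernelA (prependCoupling b g) (k+1) μ ν z| ≤ C₅ θ^{k+1} e^{−κ|z|₁}`: the η-rate of CONSECUTIVE-LEVEL limiting kernels);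
  `prefixDependenceOn_EA` (HOLDS — the object is keyed by the prefix); `lipBackground_EA`, `backgroundsClose_of_nonneg` (hold VACUOUSLY:
  one-point backgrounds — honest degeneration, no content); ★ `representsA_EA ∕ representsB_EB` (and `…_objects`): for the β of record's shape
  `betaOfMerged (betaMerged F ℰ ρ bV) β0 γ` the clauses `RepresentsA ∕ RepresentsB` with the (1.22) recipe `F′ ↦ B12Beta.secondMoment (F′ read at
  the carrier points) 0 1` HOLD BY CONSTRUCTION; the (5.10)-class binders `KernelDecay ∕ KernelDecayB` (= the consumer's two decay clauses at
  these objects, `kernelDecay_iff ∕ kernelDecayB_iff` by `Iff.rfl`) with `kernelDecayB_of_kernelDecay` (on the window `]0, γ]^ℕ` the run-B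
  clause FOLLOWS from the run-A clause: prepending `b ∈ ]0, γ]` stays in the window) and `kernelDecay_of_decayBound`.
* §5 **AT THE RECORD, Stage 13** (`Node00/Record13`): **`objectsOfRecord₁₃ F N θ ℓ`** = `objects` at the MERGED TERM FAMILY OF RECORD
  `mergedTermFamilyMatT F N (TβOfRecord₁₃ F N) (chiβOfRecord₁₃ F N θ) θ.εbg` with the record's β-chart `θ.ρ8 ∕ θ.bV` (instances bound by `letI` exactly
  as in `betaOfRecord₈Tχ`) — the «definer's one-liner» of seat n27-w1's INTENT-4; faces `objectsOfRecord₁₃_levelCarriers ∕ _toU3Letters₁₁ ∕ _EA_pt ∕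
  _populated`; ★★★ `representsA_objectsOfRecord₁₃ ∕ representsB_objectsOfRecord₁₃`: `RepresentsA ∕ RepresentsB` FOR THE β-FUNCTIONS OF RECORD
  `betaOfRecord₁₃ F N θ` with NO hypothesis; the one (5.10) binder of record `KernelDecayOfRecord₁₃ F N θ μ ν κ` with `kernelDecayOfRecord₁₃_iff`
  (`Iff.rfl` to the consumer's `hdecA`) and `kernelDecayB_objectsOfRecord₁₃` (the consumer's `hdecB` from it).

## What it buys (consumer road, Summit side — NOT in this file; checked in a scratch that is not filed)

At the DATUM OF RECORD the Summit-side `readOutAt_u3OfRecord₁₃_of_kernelSlices` (seat n27-w1) now produces the (D4) conjunct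
`ReadOutAt (datumOfRecord₁₃ F N θ h) (u3OfRecord₁₃ θ (objectsOfRecord₁₃ F N θ ℓ) k)` by ONE term from EXACTLY: `ℓ.Signs`, `0 < ℓ.κ`,
`betaPrime510 4 1 ℓ.κ ≤ ℓ.cr` and `KernelDecayOfRecord₁₃ F N θ 0 1 ℓ.κ` — `hA ∕ hB := representsA∕B_objectsOfRecord₁₃` (the β-identification is
`rfl`), `hdecA := (kernelDecayOfRecord₁₃_iff …).1 hdec`, `hdecB := kernelDecayB_objectsOfRecord₁₃ … hdec`, carrier clauses `scale_pt ∕ l1_le_d_pt`.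
Generic version: at `objects F ℰ ρ bV ℓ` and any datum with `D.βfun = betaOfMerged (betaMerged F ℰ ρ bV) β0 θ.γ`, from `KernelDecay F ℰ ρ bV (Window θ.γ)
0 1 ℓ.κ`.  The one remaining analytic input is the (5.10) p. 293 decay of the LIMITING kernels at a `k`-uniform rate, LOCATED in print as an
inductive consequence of (1.18), NOT proved anywhere in the tree.

## HONEST LIMITS

Hypothesis-schema style: OBJECTS and their definitional faces, NOTHING asserted of print's data.  `Node00.polLimit` is a TOTAL `limUnder`
whose value is the printed limit (1.21) WHEN IT EXISTS ([I] p. 264 «This limit exists by the localized representation (1.7)» — a theorem of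
[I]∕[II], neither asserted nor used here) and unspecified otherwise; `ℰ` is a PARAMETER (the Summit side instantiates it at the merged term
family of the record); the slots NE5 ∕ NE9 ∕ (5.10)-decay at these objects speak of the INFINITE-VOLUME kernels of [I] p. 264 (the carrier
clause `|z|₁ ≤ d (pt k μ ν z)` for all `z ∈ ℤ⁴` asks infinitely many scale-(k+1) domains per step — consistent with `T4BetaReadOut`'s «WHICH E:
the infinite-volume family», not with a fixed-`K` torus reading; seat n27-w1's HONEST LIMIT, repeated); NE5, NE9, (5.10) for these kernels and
the (D4) conjunct are NOT PRINTED as such ∕ NOT PROVED here; count-neutral; no node of the record is discharged; nothing continuum.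

## CITATION HEADER (D-0065)
- [I] = T. Bałaban, Renormalization group approach to lattice gauge field theories. I. Generation of effective actions in a small field
  approximation and a coupling constant renormalization in four dimensions, Comm. Math. Phys. 109 (1987) 249–301 [Balaban1987RG1]: (0.24)–(0.25)
  p. 257 (localization domains, tree length, decay); (1.18) p. 263; (1.20)–(1.22) p. 264 (quoted: «This is the vacuum polarization tensor of the
  theory defined by the j-th fluctuation field integral», «Now we take a limit of these functions as T^{(j+1)} ↗ Z^d. This limit exists by the
  localized representation (1.7)», «for μ, ν arbitrary, μ ≠ ν»); (1.6) p. 261 (the merged new term); (2.13) p. 268 (the new history-dependent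
  term); (5.10) p. 293 (kernel decay); p. 298 («β_j depends also on all preceding coupling constants»).
- [III] = T. Bałaban, Convergent renormalization expansions for lattice gauge theories, Comm. Math. Phys. 119 (1988) 243–285 [Balaban1988Convergent]:
  (2.27)–(2.28) p. 259, named ONLY as the source of the background-Lipschitz slot `T4OutputRate.LipBackground` (vacuous at this object).
- [II] = T. Bałaban, Renormalization group approach to lattice gauge field theories. II. Cluster expansions, Comm. Math. Phys. 116 (1988) 1–22
  [Balaban1988RG2Cluster]: (2.13) p. 14, (2.14) p. 15 (the history-dependent terms and their generic term — the object W1 of this seat).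
- Pages were read from the materialised text `paper:balaban1987-cmp109-rg-i-small-field` p. 264 (journal pagination; PDF p. 16) this generation,
  pp. 257, 263, 268, 293, 298 and [II] pp. 14–15 in the seat's earlier generations (lineage HANDOFF).

Typer lint: no `instance`, no `notation`, no attribute removal (`@[reducible]` is SET on the new `carriers`, as on `T4BetaReadOut.betaCarriers`,
so that `carriers.Dom` unfolds to the product type during elaboration), no `sorry`; one file for one source section ([I] (1.20)–(1.22) as the
carrier of the history terms (2.13)–(2.14), generic and at the Stage-13 record).
-/

noncomputable section

open scoped BigOperators

namespace Literature.MathematicalPhysics.QuantumFieldTheory.Balaban1983to89.Node00.U3OfKernels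

open T4Continuum (T4Family)
open T4OutputRate (Carriers Functional Window DecayBound PrefixDependenceOn LipBackground NE5 NE9 BackgroundsClose)
open T4BetaReadOut (RepresentsA RepresentsB)
open T4FlagMemory (extd extd_coe)
open B12Sec2to5 (l1 l1_nonneg Decay510)
open FlowStep (Box HBeta)

/-! ## §1. The background-free kernel carrier and the history prefix -/

/-- **THE KERNEL CARRIER**: domains `(k, μ, ν, z)` — a level `k` (creation scale `k + 1`), two directions and an integer separation `z ∈ ℤ⁴` — with
tree length `|z|₁`; one-point backgrounds for both runs (the (1.20)–(1.21) kernel is the Hessian at `B = 0`: background-free), gauge `0`, identity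
transport.  `@[reducible]` so that `carriers.Dom` unfolds to the product type (as `T4BetaReadOut.betaCarriers`).
[cite: Balaban1987RG1, (0.24)–(0.25) p.257 and (1.20)–(1.21) p.264 (objects; the pairing is NOT printed)] -/
@[reducible] def carriers : Carriers where
  Dom := ℕ × Fin 4 × Fin 4 × (Fin 4 → ℤ)
  scale := fun p => p.1 + 1
  d := fun p => l1 p.2.2.2
  d_nonneg := fun p => l1_nonneg p.2.2.2
  BgA := PUnit
  BgB := PUnit
  gauge := fun _ _ => 0
  gauge_nonneg := fun _ _ => le_rfl
  transport := fun u => u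

/-- The carrier point of the kernel entry `Π_{k+1,μν}(z)`. [cite: Balaban1987RG1, (1.21) p.264 (bookkeeping)] -/
def pt (k : ℕ) (μ ν : Fin 4) (z : Fin 4 → ℤ) : carriers.Dom := (k, μ, ν, z)

/-- The (only) run-B background label at a carrier point: the point of `PUnit`. [cite: Balaban1987RG1, (1.20) p.264 (bookkeeping)] -/
def bg (_k : ℕ) (_μ _ν : Fin 4) (_z : Fin 4 → ℤ) : carriers.BgB := PUnit.unit

/-- Face (`rfl`): creation scale `k + 1`. [cite: Balaban1987RG1, (0.24)–(0.25) p.257 (bookkeeping)] -/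
@[simp] theorem scale_pt (k : ℕ) (μ ν : Fin 4) (z : Fin 4 → ℤ) : carriers.scale (pt k μ ν z) = k + 1 := rfl

/-- Face (`rfl`): tree length `|z|₁`. [cite: Balaban1987RG1, (0.24)–(0.25) p.257 (bookkeeping)] -/
@[simp] theorem d_pt (k : ℕ) (μ ν : Fin 4) (z : Fin 4 → ℤ) : carriers.d (pt k μ ν z) = l1 z := rfl

/-- The carrier-point clause of the kernel-slice read-out: `|z|₁ ≤ d (pt k μ ν z)` (with equality). [cite: Balaban1987RG1, (0.24)–(0.25) p.257 (bookkeeping)] -/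
theorem l1_le_d_pt (k : ℕ) (μ ν : Fin 4) (z : Fin 4 → ℤ) : l1 z ≤ carriers.d (pt k μ ν z) := le_rfl

/-- Face (`rfl`): the transport is the identity. [cite: Balaban1987RG1, (0.24)–(0.25) p.257 (bookkeeping)] -/
@[simp] theorem transport_apply (u : carriers.BgB) : carriers.transport u = u := rfl

/-- Face (`rfl`): the gauge vanishes. [cite: Balaban1987RG1, §1 p.263 (bookkeeping)] -/
@[simp] theorem gauge_apply (u u' : carriers.BgA) : carriers.gauge u u' = 0 := rfl

/-- Face (`rfl`). [cite: Balaban1987RG1, (0.24)–(0.25) p.257 (bookkeeping)] -/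
@[simp] theorem scale_apply (p : carriers.Dom) : carriers.scale p = p.1 + 1 := rfl

/-- Face (`rfl`). [cite: Balaban1987RG1, (0.24)–(0.25) p.257 (bookkeeping)] -/
@[simp] theorem d_apply (p : carriers.Dom) : carriers.d p = l1 p.2.2.2 := rfl

/-- **The history a level-`k` term reads**: the prefix `(g_0, …, g_k)` of a coupling sequence. [cite: Balaban1987RG1, §5 p.298 (bookkeeping)] -/
def histPrefix (g : ℕ → ℝ) (k : ℕ) : Fin (k + 1) → ℝ := fun i => g i

/-- Face (`rfl`). [cite: Balaban1987RG1, §5 p.298 (bookkeeping)] -/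
@[simp] theorem histPrefix_apply (g : ℕ → ℝ) (k : ℕ) (i : Fin (k + 1)) : histPrefix g k i = g i := rfl

/-- ★ The prefix of a padded box history is the history. [cite: Balaban1987RG1, (1.20)–(1.22) p.264 (bookkeeping)] -/
@[simp] theorem histPrefix_extd {k : ℕ} (v : Fin (k + 1) → ℝ) : histPrefix (extd v) k = v :=
  funext fun i => extd_coe v i

/-- Two sequences with the same prefix have the same history prefix. [cite: Balaban1987RG1, §5 p.298 (bookkeeping)] -/
theorem histPrefix_congr {g g' : ℕ → ℝ} {k : ℕ} (h : ∀ i < k + 1, g i = g' i) : histPrefix g k = histPrefix g' k :=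
  funext fun i => h i i.isLt

/-- The level-`(k+1)` prefix of a prepended sequence is the datum consed in front of the level-`k` prefix.
[cite: Balaban1987RG1, (0.24)–(0.25) p.257 (re-indexing; bookkeeping)] -/
theorem histPrefix_prependCoupling (b : ℝ) (g : ℕ → ℝ) (k : ℕ) :
    histPrefix (prependCoupling b g) (k + 1) = Fin.cons b (histPrefix g k) := by
  funext i
  refine Fin.cases ?_ (fun j => ?_) i
  · simp [histPrefix, prependCoupling_zero]
  · simp [histPrefix, prependCoupling_succ]

/-- ★ Prepending `w 0` to the padded tail of a box history `w : Fin (k+2) → ℝ` and cutting at level `k + 1` returns `w`.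
[cite: Balaban1987RG1, (1.20)–(1.22) p.264 (bookkeeping)] -/
@[simp] theorem histPrefix_prependCoupling_extd_tail {k : ℕ} (w : Fin (k + 2) → ℝ) :
    histPrefix (prependCoupling (w 0) (extd (Fin.tail w))) (k + 1) = w := by
  rw [histPrefix_prependCoupling, histPrefix_extd]
  exact Fin.cons_self_tail w

/-- Prepending a coupling of `]0, γ]` keeps a sequence in the window `]0, γ]^ℕ`. [cite: Balaban1987RG1, Thm 1 p.259 (bookkeeping)] -/
theorem prependCoupling_mem_window {γ b : ℝ} (hb : 0 < b) (hbγ : b ≤ γ) {g : ℕ → ℝ} (hg : g ∈ Window γ) :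
    prependCoupling b g ∈ Window γ := by
  intro i
  cases i with
  | zero => exact ⟨hb, hbγ⟩
  | succ j => exact hg j

/-! ## §2. The limiting kernels of a term family and the two level functionals -/

section Kernels

variable {𝔄 : Type*} [NormedRing 𝔄] [NormedAlgebra ℝ 𝔄]
variable {V : Type*} [NormedAddCommGroup V] [NormedSpace ℝ V] {ι : Type*} [Fintype ι]
variable (F : T4Family) (ℰ : TermFamily1 F 𝔄) (ρ : V →L[ℝ] 𝔄) (bV : Module.Basis ι ℝ V)

/-- **RUN A's LIMITING KERNEL OF LEVEL `k + 1`** at the coupling sequence `g`: (1.21) after «T^{(k+1)} ↗ Z^d» of the term `ℰ k (g_0, …, g_k)`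
(the tree's total `Node00.polLimit`; its value is the printed limit when that limit exists). [cite: Balaban1987RG1, (1.21) p.264 and (2.13) p.268] -/
def kernelA (g : ℕ → ℝ) (k : ℕ) : B12Beta.Kernel 4 :=
  polLimit F (k + 1) (fun K => ℰ k (histPrefix g k) K) ρ bV

/-- **RUN B's LIMITING KERNEL, RE-INDEXED**: at run A's level `k` it is the level-`(k+2)` kernel of the sequence with run B's unpaired first
coupling `b` prepended (node U3's pairing `j ↦ j + 1`, NOT printed). [cite: Balaban1987RG1, (1.21) p.264 and (0.24)–(0.25) p.257 (pairing NOT printed)] -/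
def kernelB (b : ℝ) (g : ℕ → ℝ) (k : ℕ) : B12Beta.Kernel 4 :=
  kernelA F ℰ ρ bV (prependCoupling b g) (k + 1)

/-- Face: unfolding `kernelA`. [cite: Balaban1987RG1, (1.21) p.264 (bookkeeping)] -/
theorem kernelA_eq (g : ℕ → ℝ) (k : ℕ) : kernelA F ℰ ρ bV g k = polLimit F (k + 1) (fun K => ℰ k (histPrefix g k) K) ρ bV := rfl

/-- Face: unfolding `kernelB`. [cite: Balaban1987RG1, (1.21) p.264 (bookkeeping)] -/
theorem kernelB_eq (b : ℝ) (g : ℕ → ℝ) (k : ℕ) : kernelB F ℰ ρ bV b g k = kernelA F ℰ ρ bV (prependCoupling b g) (k + 1) := rfl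

/-- Face: `kernelB` with the consed history displayed. [cite: Balaban1987RG1, (1.21) p.264 (bookkeeping)] -/
theorem kernelB_eq_cons (b : ℝ) (g : ℕ → ℝ) (k : ℕ) :
    kernelB F ℰ ρ bV b g k = polLimit F (k + 2) (fun K => ℰ (k + 1) (Fin.cons b (histPrefix g k)) K) ρ bV := by
  rw [kernelB_eq, kernelA_eq, histPrefix_prependCoupling]

/-- ★ Along a padded box history the run-A kernel is the limiting kernel of `ℰ k v`. [cite: Balaban1987RG1, (1.21)–(1.22) p.264 (bookkeeping)] -/
theorem kernelA_extd {k : ℕ} (v : Fin (k + 1) → ℝ) : kernelA F ℰ ρ bV (extd v) k = polLimit F (k + 1) (fun K => ℰ k v K) ρ bV := by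
  rw [kernelA_eq, histPrefix_extd]

/-- ★ Along a padded box tail with the first coupling prepended the run-B kernel is the limiting kernel of `ℰ (k+1) w`.
[cite: Balaban1987RG1, (1.21)–(1.22) p.264 (bookkeeping)] -/
theorem kernelB_extd_tail {k : ℕ} (w : Fin (k + 2) → ℝ) :
    kernelB F ℰ ρ bV (w 0) (extd (Fin.tail w)) k = polLimit F (k + 2) (fun K => ℰ (k + 1) w K) ρ bV := by
  rw [kernelB_eq, kernelA_eq, histPrefix_prependCoupling_extd_tail]

/-- PREFIX DEPENDENCE at kernel level: the level-`(k+1)` kernel reads `g_0, …, g_k` only. [cite: Balaban1987RG1, §5 p.298 (bookkeeping)] -/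
theorem kernelA_congr {g g' : ℕ → ℝ} {k : ℕ} (h : ∀ i < k + 1, g i = g' i) : kernelA F ℰ ρ bV g k = kernelA F ℰ ρ bV g' k := by
  rw [kernelA_eq, kernelA_eq, histPrefix_congr h]

/-- (1.22) of the run-A kernel along a box history IS the merged β of record `Node00.betaMerged`. [cite: Balaban1987RG1, (1.22) p.264 (bookkeeping)] -/
theorem secondMoment_kernelA_extd {k : ℕ} (v : Fin (k + 1) → ℝ) :
    B12Beta.secondMoment (kernelA F ℰ ρ bV (extd v) k) 0 1 = betaMerged F ℰ ρ bV k v := by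
  rw [kernelA_extd]
  rfl

/-- **RUN A's LEVEL FUNCTIONAL** on the kernel carrier: at couplings `g`, the one background, and the point `(k, μ, ν, z)`, the kernel entry
`kernelA g k μ ν z`. [cite: Balaban1987RG1, (1.21) p.264 and (2.13) p.268; Balaban1988RG2Cluster, (2.13) p.14, (2.14) p.15 (objects)] -/
def EA : Functional carriers PUnit := fun g _ p => kernelA F ℰ ρ bV g p.1 p.2.1 p.2.2.1 p.2.2.2

/-- **RUN B's RE-INDEXED FIRST-COUPLING FAMILY** on the kernel carrier: `EB b g _ (k, μ, ν, z) = kernelB b g k μ ν z`.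
[cite: Balaban1987RG1, (1.21) p.264 and (0.24)–(0.25) p.257 (pairing NOT printed); Balaban1988RG2Cluster, (2.13) p.14, (2.14) p.15 (objects)] -/
def EB (b : ℝ) : Functional carriers PUnit := fun g _ p => kernelB F ℰ ρ bV b g p.1 p.2.1 p.2.2.1 p.2.2.2

/-- Face (`rfl`). [cite: Balaban1987RG1, (1.21) p.264 (bookkeeping)] -/
@[simp] theorem EA_pt (g : ℕ → ℝ) (U : PUnit) (k : ℕ) (μ ν : Fin 4) (z : Fin 4 → ℤ) :
    EA F ℰ ρ bV g U (pt k μ ν z) = kernelA F ℰ ρ bV g k μ ν z := rfl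

/-- Face (`rfl`). [cite: Balaban1987RG1, (1.21) p.264 (bookkeeping)] -/
@[simp] theorem EB_pt (b : ℝ) (g : ℕ → ℝ) (U : PUnit) (k : ℕ) (μ ν : Fin 4) (z : Fin 4 → ℤ) :
    EB F ℰ ρ bV b g U (pt k μ ν z) = kernelB F ℰ ρ bV b g k μ ν z := rfl

/-- Face (`rfl`) at a general carrier point. [cite: Balaban1987RG1, (1.21) p.264 (bookkeeping)] -/
theorem EA_apply (g : ℕ → ℝ) (U : PUnit) (p : carriers.Dom) : EA F ℰ ρ bV g U p = kernelA F ℰ ρ bV g p.1 p.2.1 p.2.2.1 p.2.2.2 := rfl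

/-- Face (`rfl`) at a general carrier point. [cite: Balaban1987RG1, (1.21) p.264 (bookkeeping)] -/
theorem EB_apply (b : ℝ) (g : ℕ → ℝ) (U : PUnit) (p : carriers.Dom) :
    EB F ℰ ρ bV b g U p = kernelB F ℰ ρ bV b g p.1 p.2.1 p.2.2.1 p.2.2.2 := rfl

/-- The pairing displayed: run B's family at level `k` is run A's functional of the prepended sequence one level up.
[cite: Balaban1987RG1, (0.24)–(0.25) p.257 (pairing NOT printed; bookkeeping)] -/
theorem EB_pt_eq_EA_succ (b : ℝ) (g : ℕ → ℝ) (U : PUnit) (k : ℕ) (μ ν : Fin 4) (z : Fin 4 → ℤ) :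
    EB F ℰ ρ bV b g U (pt k μ ν z) = EA F ℰ ρ bV (prependCoupling b g) U (pt (k + 1) μ ν z) := rfl

/-- ★ **STORAGE CLAUSE (A)** — verbatim the hypothesis `hstore` of the Summit-side `representsA_betaOfMerged_of_stores_polLimit` at `dom := pt`:
along every box history the run-A functional stores the limiting kernel of `ℰ k v`. [cite: Balaban1987RG1, (1.21)–(1.22) p.264 (bookkeeping)] -/
theorem EA_extd {k : ℕ} (v : Fin (k + 1) → ℝ) (U : PUnit) (μ ν : Fin 4) (z : Fin 4 → ℤ) :
    EA F ℰ ρ bV (extd v) U (pt k μ ν z) = polLimit F (k + 1) (fun K => ℰ k v K) ρ bV μ ν z := by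
  rw [EA_pt, kernelA_extd]

/-- ★ **STORAGE CLAUSE (B)** — verbatim the hypothesis `hstore` of the Summit-side `representsB_betaOfMerged_of_stores_polLimit` at `dom := pt`,
`bgB := bg`. [cite: Balaban1987RG1, (1.21)–(1.22) p.264 (bookkeeping)] -/
theorem EB_extd_tail {k : ℕ} (w : Fin (k + 2) → ℝ) (U : PUnit) (μ ν : Fin 4) (z : Fin 4 → ℤ) :
    EB F ℰ ρ bV (w 0) (extd (Fin.tail w)) U (pt k μ ν z) = polLimit F (k + 2) (fun K => ℰ (k + 1) w K) ρ bV μ ν z := by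
  rw [EB_pt, kernelB_extd_tail]

/-! ## §3. Node U3's objects of record keyed to the kernels -/

/-- **NODE U3's OBJECTS KEYED TO THE LIMITING KERNELS of the term family `ℰ`**: the fixed-carrier reading (`U3Objects₁₁.ofFixed`) of the kernel
carrier with the two level functionals of §2 and the K-uniform letter block `ℓ`. [cite: Balaban1987RG1, (1.20)–(1.22) p.264; Balaban1988RG2Cluster, (2.13) p.14, (2.14) p.15 (objects; the pairing is NOT printed)] -/
def objects (ℓ : U3Letters₁₁) : U3Objects₁₁ :=
  U3Objects₁₁.ofFixed carriers (EA F ℰ ρ bV) (EB F ℰ ρ bV) ℓ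

/-- Face (`rfl`). [cite: Balaban1987RG1, (1.20)–(1.22) p.264 (bookkeeping)] -/
@[simp] theorem objects_levelCarriers (ℓ : U3Letters₁₁) (k : ℕ) : (objects F ℰ ρ bV ℓ).levelCarriers k = carriers := rfl

/-- Face (`rfl`). [cite: Balaban1987RG1, (1.20)–(1.22) p.264 (bookkeeping)] -/
@[simp] theorem objects_EA (ℓ : U3Letters₁₁) (k : ℕ) : (objects F ℰ ρ bV ℓ).EA k = EA F ℰ ρ bV := rfl

/-- Face (`rfl`). [cite: Balaban1987RG1, (1.20)–(1.22) p.264 (bookkeeping)] -/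
@[simp] theorem objects_EB (ℓ : U3Letters₁₁) (k : ℕ) : (objects F ℰ ρ bV ℓ).EB k = EB F ℰ ρ bV := rfl

/-- Face (`rfl`): the letter block. [cite: Balaban1987RG1, (1.20)–(1.22) p.264 (bookkeeping)] -/
@[simp] theorem objects_toU3Letters₁₁ (ℓ : U3Letters₁₁) : (objects F ℰ ρ bV ℓ).toU3Letters₁₁ = ℓ := rfl

/-- The objects are POPULATED (the domain type is inhabited, e.g. by `(0, 0, 0, 0)`). [cite: Balaban1987RG1, (0.24)–(0.25) p.257 (bookkeeping)] -/
theorem objects_populated (ℓ : U3Letters₁₁) : (objects F ℰ ρ bV ℓ).Populated :=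
  fun _ => ⟨((0 : ℕ), (0 : Fin 4), (0 : Fin 4), (0 : Fin 4 → ℤ))⟩

/-! ## §4. The slot dictionary: node U3's shapes and the read-out clauses at these objects -/

/-- **(0.25)∕(1.18) DECAY ⟺ UNIFORM (5.10) DECAY OF THE STORED KERNELS**: `DecayBound (EA …) W E₀ κ` says exactly that every kernel
`kernelA g k μ ν`, `g ∈ W`, is in the (5.10) class `Decay510 · E₀ κ` with the SAME constant. [cite: Balaban1987RG1, (1.18) p.263 and (5.10) p.293 (dictionary; nothing asserted)] -/
theorem decayBound_EA_iff (W : Set (ℕ → ℝ)) (E₀ κ : ℝ) :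
    DecayBound (EA F ℰ ρ bV) W E₀ κ ↔ ∀ g ∈ W, ∀ (k : ℕ) (μ ν : Fin 4), Decay510 (kernelA F ℰ ρ bV g k μ ν) E₀ κ := by
  constructor
  · intro h g hg k μ ν z
    have h' := h g hg PUnit.unit (pt k μ ν z)
    rw [neg_mul]
    exact h'
  · rintro h g hg U ⟨k, μ, ν, z⟩
    have h' := h g hg k μ ν z
    rw [neg_mul] at h'
    exact h'

/-- **NE9 ⟺ JOINT HISTORY-LIPSCHITZ BOUNDS ON THE KERNELS** with moduli `Λ (k+1) i` and the decay weight `e^{−κ|z|₁}`.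
[cite: Balaban1987RG1, §1 p.263 and §5 p.298 (dictionary; NE9 is NOT printed)] -/
theorem ne9_EA_iff (W : Set (ℕ → ℝ)) (κ : ℝ) (Λ : ℕ → ℕ → ℝ) :
    NE9 (EA F ℰ ρ bV) W κ Λ ↔ ∀ g ∈ W, ∀ g' ∈ W, ∀ (k : ℕ) (μ ν : Fin 4) (z : Fin 4 → ℤ),
      |kernelA F ℰ ρ bV g k μ ν z - kernelA F ℰ ρ bV g' k μ ν z| ≤
        Real.exp (-(κ * l1 z)) * ∑ i ∈ Finset.range (k + 1), Λ (k + 1) i * |g i - g' i| := by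
  constructor
  · intro h g hg g' hg' k μ ν z
    exact h g hg g' hg' PUnit.unit (pt k μ ν z)
  · rintro h g hg g' hg' U ⟨k, μ, ν, z⟩
    exact h g hg g' hg' k μ ν z

/-- **NE5 AT FIRST COUPLING `b` ⟺ THE η-RATE OF CONSECUTIVE-LEVEL LIMITING KERNELS**: `|Π^{A}_{k+1}(g; z) − Π^{B}_{k+2}(b, g; z)| ≤ C₅ θ^{k+1} e^{−κ|z|₁}`.
[cite: Balaban1987RG1, Thm 1 p.259 (uniformity in the spacing; NE5 is NOT printed; dictionary)] -/
theorem ne5_iff (b : ℝ) (W : Set (ℕ → ℝ)) (κ θ C₅ : ℝ) :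
    NE5 (EA F ℰ ρ bV) (EB F ℰ ρ bV b) W κ θ C₅ ↔ ∀ g ∈ W, ∀ (k : ℕ) (μ ν : Fin 4) (z : Fin 4 → ℤ),
      |kernelA F ℰ ρ bV g k μ ν z - kernelA F ℰ ρ bV (prependCoupling b g) (k + 1) μ ν z| ≤
        C₅ * θ ^ (k + 1) * Real.exp (-(κ * l1 z)) := by
  constructor
  · intro h g hg k μ ν z
    exact h g hg PUnit.unit (pt k μ ν z)
  · rintro h g hg U ⟨k, μ, ν, z⟩
    exact h g hg k μ ν z

/-- **PREFIX DEPENDENCE HOLDS BY CONSTRUCTION** (the object is keyed by the history prefix). [cite: Balaban1987RG1, §0 p.256 and §5 p.298 (bookkeeping)] -/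
theorem prefixDependenceOn_EA (W : Set (ℕ → ℝ)) : PrefixDependenceOn (EA F ℰ ρ bV) W := by
  rintro g - g' - U ⟨k, μ, ν, z⟩ h
  show kernelA F ℰ ρ bV g k μ ν z = kernelA F ℰ ρ bV g' k μ ν z
  rw [kernelA_congr F ℰ ρ bV h]

/-- **THE BACKGROUND-LIPSCHITZ SLOT IS VACUOUS HERE** (one-point backgrounds, gauge `0`): it holds for every constant family and carries NO content —
honest degeneration of a background-free object. [cite: Balaban1988Convergent, (2.27)–(2.28) p.259 (slot; vacuous at this object)] -/
theorem lipBackground_EA (W : Set (ℕ → ℝ)) (κ : ℝ) (CU : (ℕ → ℝ) → ℕ → ℝ) : LipBackground (EA F ℰ ρ bV) W κ CU := by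
  intro g _ U U' X
  simp

/-- **THE BACKGROUND-CLOSENESS SLOT IS VACUOUS HERE**: any two labellings of the one-point backgrounds are `δ`-close for every `δ ≥ 0`.
[cite: Balaban1987RG1, (0.21)–(0.22) p.256 (slot; vacuous at this object)] -/
theorem backgroundsClose_of_nonneg {X : Type} (uA : X → carriers.BgA) (uB : X → carriers.BgB) {δ : ℝ} (hδ : 0 ≤ δ) :
    BackgroundsClose uA uB δ :=
  fun _ => hδ

/-- ★★ **`RepresentsA` HOLDS BY CONSTRUCTION** for the β of record's shape `betaOfMerged (betaMerged F ℰ ρ bV) β0 γ` (`Node00/BetaOfRecord`) and the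
(1.22) recipe at directions `(0, 1)` reading the slice at the carrier points: on the box `β_{k+1}(v) = Σ_z Π_{k+1,01}(v; z) z_0 z_1` of THIS object's
run-A kernel.  Pure unfolding (`betaOfMerged_of_mem`, `EA_extd`). [cite: Balaban1987RG1, (1.20)–(1.22) p.264 (bookkeeping)] -/
theorem representsA_EA (β0 : ℕ → ℝ) (γ : ℝ) :
    RepresentsA (EA F ℰ ρ bV)
      (fun k F' => B12Beta.secondMoment (fun μ ν z => F' (carriers.transport (bg k μ ν z)) (pt k μ ν z)) 0 1) γ
      (betaOfMerged (betaMerged F ℰ ρ bV) β0 γ) := by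
  intro k v hv
  rw [betaOfMerged_of_mem _ _ _ hv]
  show B12Beta.secondMoment _ 0 1 = B12Beta.secondMoment _ 0 1
  congr 1
  funext μ ν z
  exact (EA_extd F ℰ ρ bV v _ μ ν z).symm

/-- ★★ **`RepresentsB` HOLDS BY CONSTRUCTION** (run-B twin: `β_{k+2}(w)` is the (1.22) second moment of the run-B family's slice at first coupling
`w 0` and re-indexed couplings `extd (Fin.tail w)`). [cite: Balaban1987RG1, (1.20)–(1.22) p.264 (bookkeeping; the re-indexing is NOT printed)] -/
theorem representsB_EB (β0 : ℕ → ℝ) (γ : ℝ) :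
    RepresentsB (EB F ℰ ρ bV)
      (fun k G => B12Beta.secondMoment (fun μ ν z => G (bg k μ ν z) (pt k μ ν z)) 0 1) γ
      (betaOfMerged (betaMerged F ℰ ρ bV) β0 γ) := by
  intro k w hw
  rw [betaOfMerged_of_mem _ _ _ hw]
  show B12Beta.secondMoment _ 0 1 = B12Beta.secondMoment _ 0 1
  congr 1
  funext μ ν z
  exact (EB_extd_tail F ℰ ρ bV w _ μ ν z).symm

/-- `RepresentsA` in the currency of the objects of record (`(objects … ℓ).EA k`, level carriers `carriers`): the shape of the hypothesis `hA` of the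
Summit-side kernel-slice read-out at `dom := pt`, `bgB := bg`. [cite: Balaban1987RG1, (1.20)–(1.22) p.264 (bookkeeping)] -/
theorem representsA_objects (ℓ : U3Letters₁₁) (β0 : ℕ → ℝ) (γ : ℝ) (k : ℕ) :
    RepresentsA ((objects F ℰ ρ bV ℓ).EA k)
      (fun j F' => B12Beta.secondMoment (fun μ ν z => F' (((objects F ℰ ρ bV ℓ).levelCarriers k).transport (bg j μ ν z)) (pt j μ ν z)) 0 1) γ
      (betaOfMerged (betaMerged F ℰ ρ bV) β0 γ) :=
  representsA_EA F ℰ ρ bV β0 γ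

/-- `RepresentsB` in the currency of the objects of record. [cite: Balaban1987RG1, (1.20)–(1.22) p.264 (bookkeeping)] -/
theorem representsB_objects (ℓ : U3Letters₁₁) (β0 : ℕ → ℝ) (γ : ℝ) (k : ℕ) :
    RepresentsB ((objects F ℰ ρ bV ℓ).EB k)
      (fun j G => B12Beta.secondMoment (fun μ ν z => G (bg j μ ν z) (pt j μ ν z)) 0 1) γ
      (betaOfMerged (betaMerged F ℰ ρ bV) β0 γ) :=
  representsB_EB F ℰ ρ bV β0 γ

/-- **(5.10)-CLASS MEMBERSHIP OF THE RUN-A KERNELS, UNIFORMLY IN THE LEVEL** (binder only — the decay (5.10) p. 293 of the limiting kernels at a rate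
`κ`, one constant per coupling sequence of the window): `∀ g ∈ W, ∃ C₀, ∀ k, |kernelA g k μ ν z| ≤ C₀ e^{−κ|z|₁}`. [cite: Balaban1987RG1, (5.10) p.293] -/
def KernelDecay (W : Set (ℕ → ℝ)) (μ ν : Fin 4) (κ : ℝ) : Prop :=
  ∀ g ∈ W, ∃ C₀ : ℝ, ∀ k, Decay510 (kernelA F ℰ ρ bV g k μ ν) C₀ κ

/-- **(5.10)-CLASS MEMBERSHIP OF THE RUN-B KERNELS** for every unpaired first coupling `b ∈ ]0, γ]` (binder only). [cite: Balaban1987RG1, (5.10) p.293] -/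
def KernelDecayB (W : Set (ℕ → ℝ)) (γ : ℝ) (μ ν : Fin 4) (κ : ℝ) : Prop :=
  ∀ b : ℝ, 0 < b → b ≤ γ → ∀ g ∈ W, ∃ C₀ : ℝ, ∀ k, Decay510 (kernelB F ℰ ρ bV b g k μ ν) C₀ κ

/-- `KernelDecay` IS the run-A decay clause `hdecA` of the Summit-side kernel-slice read-out at these objects (`Iff.rfl`).
[cite: Balaban1987RG1, (5.10) p.293 (bookkeeping)] -/
theorem kernelDecay_iff (W : Set (ℕ → ℝ)) (μ ν : Fin 4) (κ : ℝ) :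
    KernelDecay F ℰ ρ bV W μ ν κ ↔
      ∀ g ∈ W, ∃ C₀ : ℝ, ∀ k, Decay510 (fun z => EA F ℰ ρ bV g (carriers.transport (bg k μ ν z)) (pt k μ ν z)) C₀ κ :=
  Iff.rfl

/-- `KernelDecayB` IS the run-B decay clause `hdecB` of the Summit-side kernel-slice read-out at these objects (`Iff.rfl`).
[cite: Balaban1987RG1, (5.10) p.293 (bookkeeping)] -/
theorem kernelDecayB_iff (W : Set (ℕ → ℝ)) (γ : ℝ) (μ ν : Fin 4) (κ : ℝ) :
    KernelDecayB F ℰ ρ bV W γ μ ν κ ↔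
      ∀ b : ℝ, 0 < b → b ≤ γ → ∀ g ∈ W, ∃ C₀ : ℝ, ∀ k, Decay510 (fun z => EB F ℰ ρ bV b g (bg k μ ν z) (pt k μ ν z)) C₀ κ :=
  Iff.rfl

/-- **ON THE WINDOW `]0, γ]^ℕ` THE RUN-B CLAUSE FOLLOWS FROM THE RUN-A CLAUSE**: the run-B kernels are run-A kernels of prepended sequences, and
prepending `b ∈ ]0, γ]` stays in the window. [cite: Balaban1987RG1, Thm 1 p.259 and (5.10) p.293 (bookkeeping)] -/
theorem kernelDecayB_of_kernelDecay {γ : ℝ} {μ ν : Fin 4} {κ : ℝ} (h : KernelDecay F ℰ ρ bV (Window γ) μ ν κ) :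
    KernelDecayB F ℰ ρ bV (Window γ) γ μ ν κ := by
  intro b hb hbγ g hg
  obtain ⟨C₀, hC⟩ := h _ (prependCoupling_mem_window hb hbγ hg)
  exact ⟨C₀, fun k => hC (k + 1)⟩

/-- Node U3's own decay slot (uniform constant `E₀`) IMPLIES the (5.10)-class clause at every direction pair. [cite: Balaban1987RG1, (1.18) p.263 and (5.10) p.293 (bookkeeping)] -/
theorem kernelDecay_of_decayBound {W : Set (ℕ → ℝ)} {E₀ κ : ℝ} (h : DecayBound (EA F ℰ ρ bV) W E₀ κ) (μ ν : Fin 4) :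
    KernelDecay F ℰ ρ bV W μ ν κ :=
  fun g hg => ⟨E₀, fun k => (decayBound_EA_iff F ℰ ρ bV W E₀ κ).1 h g hg k μ ν⟩

end Kernels

/-! ## §5. At the record, Stage 13: the objects keyed to the limiting kernels of the MERGED TERM FAMILY OF RECORD -/

section Record

open scoped Matrix.Norms.L2Operator

variable (F : T4Family) (N : ℕ) [NeZero N]

/-- **NODE U3's OBJECTS OF RECORD, Stage 13, KEYED TO THE LIMITING (1.21) KERNELS** — the «definer's one-liner»: `objects` at the merged term family of
record `mergedTermFamilyMatT F N (TβOfRecord₁₃ F N) (chiβOfRecord₁₃ F N θ) θ.εbg` (the (1.6) merged new term read through the β-layer transport and the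
(2.9) species of record, `Node00/Record13`), the probe `θ.ρ8` and basis `θ.bV` of the record's β-chart (instances `θ.instVβ₁ ∕ instVβ₂ ∕ instιβ` bound by
`letI`, exactly as in `betaOfRecord₈Tχ`), letter block `ℓ`.  Its run-A functional STORES the kernels whose (1.22) second moments ARE `betaOfRecord₁₃ F N θ`
on the box (§5 faces). [cite: Balaban1987RG1, (1.20)–(1.22) p.264 and (1.6) p.261; Balaban1988RG2Cluster, (2.13) p.14, (2.14) p.15 (objects; the pairing is NOT printed)] -/
def objectsOfRecord₁₃ (θ : Stage13Params F N) (ℓ : U3Letters₁₁) : U3Objects₁₁ :=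
  letI := θ.instVβ₁; letI := θ.instVβ₂; letI := θ.instιβ
  objects F (mergedTermFamilyMatT F N (TβOfRecord₁₃ F N) (chiβOfRecord₁₃ F N θ) θ.εbg) θ.ρ8 θ.bV ℓ

/-- Face (`rfl`): the level carriers of the objects of record are the kernel carrier. [cite: Balaban1987RG1, (1.20)–(1.22) p.264 (bookkeeping)] -/
@[simp] theorem objectsOfRecord₁₃_levelCarriers (θ : Stage13Params F N) (ℓ : U3Letters₁₁) (k : ℕ) :
    (objectsOfRecord₁₃ F N θ ℓ).levelCarriers k = carriers := rfl

/-- Face (`rfl`): the letter block. [cite: Balaban1987RG1, (1.20)–(1.22) p.264 (bookkeeping)] -/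
@[simp] theorem objectsOfRecord₁₃_toU3Letters₁₁ (θ : Stage13Params F N) (ℓ : U3Letters₁₁) : (objectsOfRecord₁₃ F N θ ℓ).toU3Letters₁₁ = ℓ := rfl

/-- Face (`rfl`): run A's level functional of record at a carrier point is the limiting kernel of the merged term of record.
[cite: Balaban1987RG1, (1.21) p.264 and (1.6) p.261 (bookkeeping)] -/
theorem objectsOfRecord₁₃_EA_pt (θ : Stage13Params F N) (ℓ : U3Letters₁₁) (j : ℕ) (g : ℕ → ℝ) (U : PUnit) (k : ℕ) (μ ν : Fin 4) (z : Fin 4 → ℤ) :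
    (objectsOfRecord₁₃ F N θ ℓ).EA j g U (pt k μ ν z) =
      (letI := θ.instVβ₁; letI := θ.instVβ₂; letI := θ.instιβ
       polLimit F (k + 1) (fun K => mergedTermFamilyMatT F N (TβOfRecord₁₃ F N) (chiβOfRecord₁₃ F N θ) θ.εbg k (histPrefix g k) K) θ.ρ8 θ.bV μ ν z) :=
  rfl

/-- The objects of record are POPULATED. [cite: Balaban1987RG1, (0.24)–(0.25) p.257 (bookkeeping)] -/
theorem objectsOfRecord₁₃_populated (θ : Stage13Params F N) (ℓ : U3Letters₁₁) : (objectsOfRecord₁₃ F N θ ℓ).Populated :=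
  fun _ => ⟨((0 : ℕ), (0 : Fin 4), (0 : Fin 4), (0 : Fin 4 → ℤ))⟩

/-- ★★★ **`RepresentsA` FOR THE β-FUNCTIONS OF RECORD `betaOfRecord₁₃ F N θ` HOLDS BY CONSTRUCTION at the objects of record** (every level `k`; the
(1.22) recipe at directions `(0, 1)` reading the slice at the carrier points `pt`, run-B labels `bg`): NO hypothesis — the shape of `hA` of the Summit-side
kernel-slice read-out at the datum of record (`βfun := betaOfRecord₁₃ F N θ`). [cite: Balaban1987RG1, (1.20)–(1.22) p.264 (bookkeeping)] -/
theorem representsA_objectsOfRecord₁₃ (θ : Stage13Params F N) (ℓ : U3Letters₁₁) (k : ℕ) :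
    RepresentsA ((objectsOfRecord₁₃ F N θ ℓ).EA k)
      (fun j F' => B12Beta.secondMoment (fun μ ν z => F' (((objectsOfRecord₁₃ F N θ ℓ).levelCarriers k).transport (bg j μ ν z)) (pt j μ ν z)) 0 1)
      θ.γ (betaOfRecord₁₃ F N θ) := by
  letI := θ.instVβ₁; letI := θ.instVβ₂; letI := θ.instιβ
  exact representsA_objects F (mergedTermFamilyMatT F N (TβOfRecord₁₃ F N) (chiβOfRecord₁₃ F N θ) θ.εbg) θ.ρ8 θ.bV ℓ
    (beta0OfMerged (betaMerged F (mergedTermFamilyMatT F N (TβOfRecord₁₃ F N) (chiβOfRecord₁₃ F N θ) θ.εbg) θ.ρ8 θ.bV) θ.v₀) θ.γ k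

/-- ★★★ **`RepresentsB` FOR `betaOfRecord₁₃ F N θ` HOLDS BY CONSTRUCTION at the objects of record** (run-B twin; NO hypothesis).
[cite: Balaban1987RG1, (1.20)–(1.22) p.264 (bookkeeping; the re-indexing is NOT printed)] -/
theorem representsB_objectsOfRecord₁₃ (θ : Stage13Params F N) (ℓ : U3Letters₁₁) (k : ℕ) :
    RepresentsB ((objectsOfRecord₁₃ F N θ ℓ).EB k)
      (fun j G => B12Beta.secondMoment (fun μ ν z => G (bg j μ ν z) (pt j μ ν z)) 0 1)
      θ.γ (betaOfRecord₁₃ F N θ) := by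
  letI := θ.instVβ₁; letI := θ.instVβ₂; letI := θ.instιβ
  exact representsB_objects F (mergedTermFamilyMatT F N (TβOfRecord₁₃ F N) (chiβOfRecord₁₃ F N θ) θ.εbg) θ.ρ8 θ.bV ℓ
    (beta0OfMerged (betaMerged F (mergedTermFamilyMatT F N (TβOfRecord₁₃ F N) (chiβOfRecord₁₃ F N θ) θ.εbg) θ.ρ8 θ.bV) θ.v₀) θ.γ k

/-- **THE (5.10)-CLASS CLAUSE OF RECORD** at directions `(μ, ν)` and rate `κ` (binder only): the limiting kernels of the merged term of record decay at the
`k`-uniform rate `κ` along every coupling sequence of the window `]0, θ.γ]^ℕ`. [cite: Balaban1987RG1, (5.10) p.293] -/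
def KernelDecayOfRecord₁₃ (θ : Stage13Params F N) (μ ν : Fin 4) (κ : ℝ) : Prop :=
  letI := θ.instVβ₁; letI := θ.instVβ₂; letI := θ.instιβ
  KernelDecay F (mergedTermFamilyMatT F N (TβOfRecord₁₃ F N) (chiβOfRecord₁₃ F N θ) θ.εbg) θ.ρ8 θ.bV (Window θ.γ) μ ν κ

/-- `KernelDecayOfRecord₁₃` IS the run-A decay clause `hdecA` of the Summit-side kernel-slice read-out at the objects of record (`Iff.rfl`).
[cite: Balaban1987RG1, (5.10) p.293 (bookkeeping)] -/
theorem kernelDecayOfRecord₁₃_iff (θ : Stage13Params F N) (ℓ : U3Letters₁₁) (j : ℕ) (μ ν : Fin 4) (κ : ℝ) :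
    KernelDecayOfRecord₁₃ F N θ μ ν κ ↔
      ∀ g ∈ Window θ.γ, ∃ C₀ : ℝ, ∀ k,
        Decay510 (fun z => (objectsOfRecord₁₃ F N θ ℓ).EA j g (((objectsOfRecord₁₃ F N θ ℓ).levelCarriers j).transport (bg k μ ν z)) (pt k μ ν z)) C₀ κ :=
  Iff.rfl

/-- At the objects of record the run-B decay clause `hdecB` FOLLOWS from `KernelDecayOfRecord₁₃` (`kernelDecayB_of_kernelDecay`).
[cite: Balaban1987RG1, Thm 1 p.259 and (5.10) p.293 (bookkeeping)] -/
theorem kernelDecayB_objectsOfRecord₁₃ (θ : Stage13Params F N) (ℓ : U3Letters₁₁) (j : ℕ) {μ ν : Fin 4} {κ : ℝ} (h : KernelDecayOfRecord₁₃ F N θ μ ν κ) :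
    ∀ b : ℝ, 0 < b → b ≤ θ.γ → ∀ g ∈ Window θ.γ, ∃ C₀ : ℝ, ∀ k,
      Decay510 (fun z => (objectsOfRecord₁₃ F N θ ℓ).EB j b g (bg k μ ν z) (pt k μ ν z)) C₀ κ := by
  letI := θ.instVβ₁; letI := θ.instVβ₂; letI := θ.instιβ
  exact kernelDecayB_of_kernelDecay F (mergedTermFamilyMatT F N (TβOfRecord₁₃ F N) (chiβOfRecord₁₃ F N θ) θ.εbg) θ.ρ8 θ.bV h

end Record

end Literature.MathematicalPhysics.QuantumFieldTheory.Balaban1983to89.Node00.U3OfKernels
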